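import Summits.QuantumFields.YangMills.Theorems.SqueezedSkewnessChiChain
import HarnessLib

/-!
# Route `SqueezedSkewness`, LINE χ₄ «RP chessboard escalator»: `BalabanLadder.NT` (stmt-QuantumFields-19353) from
# `FemtoTwoPointUnit`, the RP chord escalator (registered stub 7 of node 23719) and `ShellSign` — kernel-checked

Fleet lead `ym-spine-19353-p1` g20.  The node skeleton `Cruxes/NT/Lines/pointlike_nodeB_birth.lean` (v3, planner ym-idea-6 g12)
registers stub 7 `stub_rpChordEscalator` — the chord escalator re-proved from reflection positivity + Cauchy–Schwarz for time translates
(stubs A/B, TAKEN by width seat ym-line-sfw-p2-w2 g24) — so that `TorusKL` (23204) leaves the χ path.  This file records, on the Theorems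
side and with stub 7's registered statement spelled out as an explicit HYPOTHESIS (no dependency on its proof):

* `pointlikeHypercubeFloorsB_of_rpEscalator : FemtoFloorUnit → (stub 7) → PointlikeHypercubeFloorsB` — the skeleton's composition
  `PointlikeHypercubeFloorsB_of_rp` with the landed `FemtoCeilingProof.femtoCeiling_proof`;
* `nt_of_femtoTwoPointUnit_rpEscalator_shellSign : FemtoTwoPointUnit → (stub 7) → ShellSign → BalabanLadder.NT` — with the landed
  `CollarBumpFloors` (23680, this seat) + `FemtoCurrencyGlue`, and the route's `closes` (rev 22) fed by the PROVED `SeamFromMoments`,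
  `HypercubeSeam`, `ShellGeometry`.

Once `stub_rpChordEscalator` lands by name, `NT ⇐ FemtoTwoPointUnit (23679) ∧ ShellSign (27861)` is the three-term application of the
second theorem.  HONEST FRAMING: compositions only; the three hypotheses are OPEN (23679 engine-grade, 27861 OPE sign, stub 7 in flight);
no NT statement, rung of record or mass gap is proved; not Clay. [folklore]
-/

set_option autoImplicit false

namespace Summit.QuantumFields.YangMills.Theorems.SqueezedSkewnessChiChainRP

open Summit.QuantumFields.YangMills.Theses.SqueezedSkewness

/-- **Node B from the RP chord escalator** (skeleton composition `PointlikeHypercubeFloorsB_of_rp`, stub 7 as an explicit hypothesis;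
the femto ceiling from the landed `femtoCeiling_proof`). [folklore] -/
theorem pointlikeHypercubeFloorsB_of_rpEscalator (h1 : FemtoFloorUnit)
    (h4 : ∀ (G : Type) [Group G] [TopologicalSpace G] [IsTopologicalGroup G] [CompactSpace G], Literature.MathematicalPhysics.QuantumFieldTheory.IsCompactSimpleLieGroup G → letI : MeasurableSpace G := borel G; haveI : BorelSpace G := ⟨rfl⟩; ∀ (r : Literature.MathematicalPhysics.QuantumFieldTheory.LatticeRep G), let St : ℕ → ℕ → Type := fun S T => Literature.MathematicalPhysics.QuantumFieldTheory.FinTorusSite S S S T; let Cfg : ℕ → ℕ → Type := fun S T => Literature.MathematicalPhysics.QuantumFieldTheory.FinTorusSite S S S T × Fin 4 → G; let cc : (n : ℕ) → Fin n → ℤ := fun n i => if 2 * i.val < n then (i.val : ℤ) else (i.val : ℤ) - n; let posE : (S T : ℕ) → St S T → EuclideanSpace ℝ (Fin 4) := fun S T x => Literature.MathematicalPhysics.QuantumLattice.siteToE (d := 4) ![cc T x.2.2.2, cc S x.1, cc S x.2.1, cc S x.2.2.1]; let P : (S T : ℕ) → St S T → Fin 4 → Fin 4 → Cfg S T → ℝ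 := fun _ _ x i j U => (r.ρ (Literature.MathematicalPhysics.QuantumFieldTheory.finTorusPlaquette U x i j)).trace.re; let A : (S T : ℕ) → St S T → Cfg S T → ℝ := fun S T x U => ∑ q : {q : Fin 4 × Fin 4 // q.1 < q.2}, P S T x q.1.1 q.1.2 U; let w : ℝ → (S T : ℕ) → Cfg S T → ℝ := fun β S T U => Real.exp (-β * ∑ x : St S T, ∑ q : {q : Fin 4 × Fin 4 // q.1 < q.2}, ((r.N : ℝ) - P S T x q.1.1 q.1.2 U)); let E : ℝ → (S T : ℕ) → (Cfg S T → ℝ) → ℝ := fun β S T F => (∫ U : Literature.MathematicalPhysics.QuantumFieldTheory.FinTorusSite S S S T × Fin 4 → G, F U * w β S T U ∂MeasureTheory.Measure.pi (fun _ => Literature.MathematicalPhysics.QuantumFieldTheory.haarProbability G)) / Literature.MathematicalPhysics.QuantumFieldTheory.wilsonFinTorusPartition r.ρ β S S S T; let Cov : ℝ → (S T : ℕ) → (Cfg S T → ℝ) → (Cfg S T → ℝ) → ℝ := fun β S T F F' => E β S T (fun U => F U * F' U) - E β S T F * E β S T F'; let refl : (S T : ℕ) → Cfg S T → Cfg S T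 := fun _ T U e => if e.2 = Fin.last 3 then (U ((e.1.1, e.1.2.1, e.1.2.2.1, Fin.rev e.1.2.2.2), Fin.last 3))⁻¹ else U ((e.1.1, e.1.2.1, e.1.2.2.1, ⟨(T - e.1.2.2.2.val) % T, Nat.mod_lt _ e.1.2.2.2.pos⟩), e.2); let B : (S T : ℕ) → ℝ → SchwartzMap (EuclideanSpace ℝ (Fin 4)) ℝ → Cfg S T → ℝ := fun S T s f U => ∑ x : St S T, f (s • posE S T x) * A S T x U; let Qrp : ℝ → (S T : ℕ) → ℝ → SchwartzMap (EuclideanSpace ℝ (Fin 4)) ℝ → ℝ := fun β S T s f => Cov β S T (fun U => B S T s f (refl S T U)) (B S T s f); ∀ (β : ℝ) (L : ℕ) (s : ℝ) (v : SchwartzMap (EuclideanSpace ℝ (Fin 4)) ℝ) (ρ δ₁ δ₂ h₁ hc ε C : ℝ), 0 ≤ β → 1 ≤ L → 0 < s → s ≤ hc → hc ≤ h₁ → 3 * h₁ ≤ δ₁ → s ≤ 1 → ρ + δ₂ + 1 ≤ s * L → tsupport (v : EuclideanSpace ℝ (Fin 4) → ℝ) ⊆ Metric.closedBall (EuclideanSpace.single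 (0 : Fin 4) (1 : ℝ)) ρ → tsupport v ⊆ {y : EuclideanSpace ℝ (Fin 4) | δ₁ < y 0 ∧ y 0 < δ₂} → 0 < ε → ε ≤ 1 → 1 ≤ C → (∀ (k : ℕ) (f : SchwartzMap (EuclideanSpace ℝ (Fin 4)) ℝ), h₁ ≤ δ₁ - s * k → δ₁ - s * k ≤ 3 * h₁ → (∀ y, f y = v (y + (s * k) • EuclideanSpace.single (0 : Fin 4) (1 : ℝ))) → ε ≤ Qrp β (2 * L + 1) (2 * L + 1) s f) → (∀ (k : ℕ) (g : SchwartzMap (EuclideanSpace ℝ (Fin 4)) ℝ), hc ≤ δ₁ - s * k → (∀ y, g y = v (y + (s * k) • EuclideanSpace.single (0 : Fin 4) (1 : ℝ))) → Qrp β (2 * L + 1) (2 * L + 1) s g ≤ C) → ε ^ (⌈2 * δ₁ / h₁⌉₊ + 1) / C ^ (⌈2 * δ₁ / h₁⌉₊ + 1) ≤ Qrp β (2 * L + 1) (2 * L + 1) s v) :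
    PointlikeHypercubeFloorsB := by
  intro G i1 i2 i3 i4 hG
  letI : MeasurableSpace G := borel G
  haveI : BorelSpace G := ⟨rfl⟩
  obtain ⟨r, a, h1'⟩ := h1 G hG
  refine ⟨r, a, ?_⟩
  dsimp only at h1' ⊢
  obtain ⟨ha, ha0, hF6, hall⟩ := h1'
  refine ⟨ha, ha0, hF6, fun ρ hρ => ?_⟩
  obtain ⟨v, hv0, hball, δ₁, δ₂, h₁, ε, β₅, Λ₅, hδ₁, hslab, hh₁, h3h₁, hε, hfloor⟩ := hall ρ hρ
  -- the femto ceiling of the unit (from `FBL6`)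
  have h5' := Summit.QuantumFields.YangMills.Theorems.FemtoCeilingProof.femtoCeiling_proof G hG r a ha ha0 hF6
  dsimp only at h5'
  obtain ⟨C, β₆, Λ₆, hceil⟩ := h5' v ρ δ₁ δ₂ h₁ hh₁ hball hslab
  -- the RP chord escalator of the hypercube
  have h4' := h4 G hG r
  dsimp only at h4'
  -- thresholds: `a β ≤ min h₁ 1` eventually
  obtain ⟨β₇, hβ₇⟩ : ∃ β₇ : ℝ, ∀ β, β₇ ≤ β → a β < min h₁ 1 := by
    have h1 : ∀ᶠ β in Filter.atTop, a β < min h₁ 1 :=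
      ha0.eventually (gt_mem_nhds (lt_min hh₁ one_pos))
    exact Filter.eventually_atTop.mp h1
  refine ⟨v, hv0, hball, δ₁, δ₂, (min ε 1) ^ (⌈2 * δ₁ / h₁⌉₊ + 1) / (max C 1) ^ (⌈2 * δ₁ / h₁⌉₊ + 1),
    max β₅ (max β₆ (max β₇ 0)), max Λ₅ (max Λ₆ (ρ + |δ₂| + 1)), hδ₁, hslab, by positivity, ?_⟩
  intro β hβ L hL
  simp only [max_le_iff] at hβ hL
  obtain ⟨hβ5, hβ6, hβ7, hβ0⟩ := hβ
  obtain ⟨hΛ5, hΛ6, hΛρ⟩ := hL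
  have hs : 0 < a β := ha β
  have hsh : a β ≤ h₁ := (hβ₇ β hβ7).le.trans (min_le_left _ _)
  have hs1 : a β ≤ 1 := (hβ₇ β hβ7).le.trans (min_le_right _ _)
  have hL1 : 1 ≤ L := by
    have h1 : (1 : ℝ) ≤ a β * L := by linarith [abs_nonneg δ₂, hρ.le]
    have h2 : (1 : ℝ) ≤ (L : ℝ) := h1.trans (mul_le_of_le_one_left (Nat.cast_nonneg L) hs1)
    exact_mod_cast h2
  have hwin : ρ + δ₂ + 1 ≤ a β * L := by linarith [le_abs_self δ₂]
  exact h4' β L (a β) v ρ δ₁ δ₂ h₁ h₁ (min ε 1) (max C 1) hβ0 hL1 hs hsh le_rfl h3h₁ hs1 hwin hball hslab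
    (lt_min hε one_pos) (min_le_right _ _) (le_max_right _ _)
    (fun k f hk1 hk2 hf => (min_le_left _ _).trans (hfloor β hβ5 L hΛ5 (a β * k) f hk1 hk2 hf))
    (fun k g hk hg => (hceil β hβ6 L hΛ6 k g hk hg).trans (le_max_left _ _))



/-- **The TorusKL-free χ-chain to the rung leaf**: `FemtoTwoPointUnit → (stub 7: RP chord escalator) → ShellSign → BalabanLadder.NT`.
[folklore] -/
theorem nt_of_femtoTwoPointUnit_rpEscalator_shellSign (hU : FemtoTwoPointUnit)
    (h4 : ∀ (G : Type) [Group G] [TopologicalSpace G] [IsTopologicalGroup G] [CompactSpace G], Literature.MathematicalPhysics.QuantumFieldTheory.IsCompactSimpleLieGroup G → letI : MeasurableSpace G := borel G; haveI : BorelSpace G := ⟨rfl⟩; ∀ (r : Literature.MathematicalPhysics.QuantumFieldTheory.LatticeRep G), let St : ℕ → ℕ → Type := fun S T => Literature.MathematicalPhysics.QuantumFieldTheory.FinTorusSite S S S T; let Cfg : ℕ → ℕ → Type := fun S T => Literature.MathematicalPhysics.QuantumFieldTheory.FinTorusSite S S S T × Fin 4 → G; let cc : (n : ℕ) → Fin n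 → ℤ := fun n i => if 2 * i.val < n then (i.val : ℤ) else (i.val : ℤ) - n; let posE : (S T : ℕ) → St S T → EuclideanSpace ℝ (Fin 4) := fun S T x => Literature.MathematicalPhysics.QuantumLattice.siteToE (d := 4) ![cc T x.2.2.2, cc S x.1, cc S x.2.1, cc S x.2.2.1]; let P : (S T : ℕ) → St S T → Fin 4 → Fin 4 → Cfg S T → ℝ := fun _ _ x i j U => (r.ρ (Literature.MathematicalPhysics.QuantumFieldTheory.finTorusPlaquette U x i j)).trace.re; let A : (S T : ℕ) → St S T → Cfg S T → ℝ := fun S T x U => ∑ q : {q : Fin 4 × Fin 4 // q.1 < q.2}, P S T x q.1.1 q.1.2 U; let w : ℝ → (S T : ℕ) → Cfg S T → ℝ := fun β S T U => Real.exp (-β * ∑ x : St S T, ∑ q : {q : Fin 4 × Fin 4 // q.1 < q.2}, ((r.N : ℝ) - P S T x q.1.1 q.1.2 U)); let E : ℝ → (S T : ℕ) → (Cfg S T → ℝ) → ℝ := fun β S T F => (∫ U : Literature.MathematicalPhysics.QuantumFieldTheory.FinTorusSite S S S T × Fin 4 → G, F U * w β S T U ∂MeasureTheory.Measure.pi (fun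 _ => Literature.MathematicalPhysics.QuantumFieldTheory.haarProbability G)) / Literature.MathematicalPhysics.QuantumFieldTheory.wilsonFinTorusPartition r.ρ β S S S T; let Cov : ℝ → (S T : ℕ) → (Cfg S T → ℝ) → (Cfg S T → ℝ) → ℝ := fun β S T F F' => E β S T (fun U => F U * F' U) - E β S T F * E β S T F'; let refl : (S T : ℕ) → Cfg S T → Cfg S T := fun _ T U e => if e.2 = Fin.last 3 then (U ((e.1.1, e.1.2.1, e.1.2.2.1, Fin.rev e.1.2.2.2), Fin.last 3))⁻¹ else U ((e.1.1, e.1.2.1, e.1.2.2.1, ⟨(T - e.1.2.2.2.val) % T, Nat.mod_lt _ e.1.2.2.2.pos⟩), e.2); let B : (S T : ℕ) → ℝ → SchwartzMap (EuclideanSpace ℝ (Fin 4)) ℝ → Cfg S T → ℝ := fun S T s f U => ∑ x : St S T, f (s • posE S T x) * A S T x U; let Qrp : ℝ → (S T : ℕ) → ℝ → SchwartzMap (EuclideanSpace ℝ (Fin 4)) ℝ → ℝ := fun β S T s f => Cov β S T (fun U => B S T s f (refl S T U)) (B S T s f); ∀ (β : ℝ) (L : ℕ) (s : ℝ) (v :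 SchwartzMap (EuclideanSpace ℝ (Fin 4)) ℝ) (ρ δ₁ δ₂ h₁ hc ε C : ℝ), 0 ≤ β → 1 ≤ L → 0 < s → s ≤ hc → hc ≤ h₁ → 3 * h₁ ≤ δ₁ → s ≤ 1 → ρ + δ₂ + 1 ≤ s * L → tsupport (v : EuclideanSpace ℝ (Fin 4) → ℝ) ⊆ Metric.closedBall (EuclideanSpace.single (0 : Fin 4) (1 : ℝ)) ρ → tsupport v ⊆ {y : EuclideanSpace ℝ (Fin 4) | δ₁ < y 0 ∧ y 0 < δ₂} → 0 < ε → ε ≤ 1 → 1 ≤ C → (∀ (k : ℕ) (f : SchwartzMap (EuclideanSpace ℝ (Fin 4)) ℝ), h₁ ≤ δ₁ - s * k → δ₁ - s * k ≤ 3 * h₁ → (∀ y, f y = v (y + (s * k) • EuclideanSpace.single (0 : Fin 4) (1 : ℝ))) → ε ≤ Qrp β (2 * L + 1) (2 * L + 1) s f) → (∀ (k : ℕ) (g : SchwartzMap (EuclideanSpace ℝ (Fin 4)) ℝ), hc ≤ δ₁ - s * k → (∀ y, g y = v (y + (s * k) • EuclideanSpace.single (0 : Fin 4) (1 : ℝ)))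 → Qrp β (2 * L + 1) (2 * L + 1) s g ≤ C) → ε ^ (⌈2 * δ₁ / h₁⌉₊ + 1) / C ^ (⌈2 * δ₁ / h₁⌉₊ + 1) ≤ Qrp β (2 * L + 1) (2 * L + 1) s v)
    (hSign : ShellSign) : Summit.QuantumFields.YangMills.Theses.BalabanLadder.NT :=
  closes
    (pointlikeHypercubeFloorsB_of_rpEscalator
      (Summit.QuantumFields.YangMills.Theorems.squeezedSkewness_femtoCurrencyGlue_proof hU
        Summit.QuantumFields.YangMills.Theorems.CollarBumpFloorsProof.collarBumpFloors_proof) h4)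
    Summit.QuantumFields.YangMills.Theorems.squeezedSkewness_seamFromMoments_proof
    Summit.QuantumFields.YangMills.Theorems.squeezedSkewness_hypercubeSeam
    Summit.QuantumFields.YangMills.Theorems.squeezedSkewness_shellGeometry hSign

end Summit.QuantumFields.YangMills.Theorems.SqueezedSkewnessChiChainRP
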